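import Summits.BirchSwinnertonDyer.BirchSwinnertonDyer.Theorems.ManinLocalTwoThreeManinConstantOneSeventySix
import Summits.BirchSwinnertonDyer.BirchSwinnertonDyer.Theorems.ManinLocalTwoThreeRootSqueezeEleven
import Summits.BirchSwinnertonDyer.BirchSwinnertonDyer.Theorems.ManinLocalTwoThreeNeronSqueeze
import Summits.BirchSwinnertonDyer.Rank1Residual.ManinAdditive.HalfTranslateTwistStep
import Literature.NumberTheory.EllipticCurves.ManinConstantQuadraticTwistAtTwoProofs
import Literature.NumberTheory.EllipticCurves.LocalReductionKrausMinimality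
import Literature.NumberTheory.EllipticCurves.QuadraticTwist
import HarnessLib

/-!
# Level 176 = 2⁴·11, the THIRD row `176b = (11a)^{χ₋₄}` — LEVEL 176 COMPLETE, fact-free: `|c| = 1` and `2 ∤ c` for EVERY
# lattice-optimal `X₀(176)`-datum of every globally minimal elliptic curve over `ℚ`

Cell `bsd-f2-manin`, route `ManinLocalTwoThree`, crux C2 `ManinOddAtFour` (stmt-BirchSwinnertonDyer-22967: `2² ∣ 176`); prover seat p3 gen 27;
`--supports` (helper).  p2 g31's `…ManinConstantOneSeventySix` closed the rows `176a = (88a)^{χ₋₄}`, `176c = (44a)^{χ₋₄}` (`a₃(W) ≠ 1`) and left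
`176b = (11a)^{χ₋₄}` (`a₃(W) = 1`) OPEN: "needs (S2)₁₁".  This seat's `…RootSqueezeEleven` supplies (S2)₁₁ for the level-`44` lift `ι₁φ₁₁`
(weight-4 Bracket–Sturm certificate on `X₀(44)`), and the row closes by the plain `Γ₀`-twisting theorem (no half-translate: the root `11a` is GOOD
at `2`, the tree's even-killing dyadic engines do not apply, and need not):
* an g55's row (`PinningOneSeventySix.f_eq_charTwist_eleven_of_lFunction_three`): `a₃(W) = 1 ⇒ D.f = (φ₁₁)^{χ₋₄}` in `S₂(Γ₀(176))`, rewritten on the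
  level-`44` lift (`charTwist_phi11_eq_charTwist_iota`: same `q`-expansion);
* Stevens (5.4) / Shimura 3.64 (`gaussSum_mul_mem_periodLattice_of_mem_charTwist`): `g(χ₋₄)·Λ(D.f) ⊆ Λ(ι₁φ₁₁) ⊆ Λ_Néron(11a1)` ((S2)₁₁);
* the twist model: `(½, −¼, 0, 0) • (11a1)^{(−1)} = C := [0, 1, 0, −165, 1427]`, `(½)¹²·Δ(C) = Δ(11a1)` (`Δ(C) = −2¹²·11⁵`; `C` is globally minimal by
  KRAUS's test at `2` — `2¹² ∣ Δ`, so Silverman's criterion does not apply — and `11⁵ ∥ Δ`); with `s = g(χ₋₄)/2`, `s² = −1`, `r = ½` the tree's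
  `neronLattice_mem_iff_of_twist_of_sq_eq` reads `z ∈ Λ_C ↔ g(χ₋₄)·z ∈ Λ(11a1)`; hence `Λ(D.f) ⊆ Λ_C` and p3's Néron squeeze gives `|c(D)| = 1`.
(`C` is a non-optimal member of the class `176b` — the optimal curve `176b1 = [0,1,0,−5,−13]` is `(11a3)^{χ₋₄}` — which is immaterial for the squeeze:
ANY globally minimal `W₀` with `Λ(D.f) ⊆ Λ_{W₀}` forces `|c| = 1`.)
RESULTS: `abs_maninConstant_eq_one_oneSeventySix_of_lFunction_three_eq_one` (row `b`), and the hypothesis-free LEVEL statements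
`abs_maninConstant_eq_one_oneSeventySix`, `not_two_dvd_maninConstant_oneSeventySix`, `maninOddAtFour_oneSeventySix : 2² ∣ 176 ∧ ∀ W D, hopt → |c| = 1 ∧ 2 ∤ c`.
HONEST FRAMING: unconditional (standard axioms); ONE level of C2 — nothing here proves C2 for all `N`, Manin's conjecture or BSD; item 22967 stays OPEN.
[cite: Stevens1989, Lemma (5.4) p. 97] [cite: Shimura1971, Prop. 3.64] [cite: Pal2012, Lemma 3.1] [cite: Kraus1989, Prop. 2] [cite: AgasheRibetStein2006, §§1–2]
[cite: CremonaAlgorithms1997, §2.10, Table 1 (11a1, 176b)] [cite: MontgomeryVaughan2007, Thm. 9.17]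
-/

set_option autoImplicit false
-- lint-debt: the directory name repeats the summit name (sibling precedent `ManinLocalTwoThreeManinConstantOneSeventySix.lean`)
set_option linter.dupNamespace false

noncomputable section

open Complex
open UpperHalfPlane hiding I
open scoped MatrixGroups ModularForm
open ModularForm CongruenceSubgroup PowerSeries
open Literature.NumberTheory.ModularForms
open Literature.NumberTheory.EllipticCurves Literature.NumberTheory.EllipticCurves.ModularForms

namespace Summit.BirchSwinnertonDyer.BirchSwinnertonDyer.Theorems.ManinLocalTwoThree.LevelOneSeventySix

open PinningOneSeventySix RootSqueezeEleven WeierstrassCurve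
open Literature.NumberTheory.EllipticCurves.Rank1Residual.X11RankOneCertificates (discOf c4Of c6Of)
open Summit.BirchSwinnertonDyer.Rank1Residual.ManinAdditive (neronLattice_mem_iff_of_twist_of_sq_eq)

/-! ## §1 The curve `C = [0, 1, 0, −165, 1427]` in the class `176b`: a globally minimal model of `(11a1)^{(−1)}` -/

/-- `Δ, c₄, c₆` of `C`: `−659664896 = −2¹²·11⁵, 7936, −1280512`. [cite: CremonaAlgorithms1997, Table 1 (176b)] -/
theorem invariants_C176b : discOf [0, 1, 0, -165, 1427] = -659664896 ∧ c4Of [0, 1, 0, -165, 1427] = 7936 ∧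
    c6Of [0, 1, 0, -165, 1427] = -1280512 := by
  refine ⟨?_, ?_, ?_⟩ <;> decide

/-- `C` (integer-cast model) is globally minimal: KRAUS's test at `2` (`2²⁴ ∤ Δ`, `2¹¹ ∤ c₆`, `2¹¹ ∤ c₆ − 2⁹`, `2⁸ ∤ c₆ + 2⁶`), `11⁵ ∥ Δ`, no other prime.
[cite: Kraus1989, Prop. 2] [cite: SilvermanAEC2009, VII.1 Remark 1.1] -/
theorem isGloballyMinimal_C176b_cast :
    (⟨((0 : ℤ) : ℚ), ((1 : ℤ) : ℚ), ((0 : ℤ) : ℚ), ((-165 : ℤ) : ℚ), ((1427 : ℤ) : ℚ)⟩ : WeierstrassCurve ℚ).IsGloballyMinimal := by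
  obtain ⟨hD, h4, h6⟩ := invariants_C176b
  refine WeierstrassCurve.isGloballyMinimal_of_int_kraus 0 1 0 (-165) 1427 fun q hq ↦ ?_
  by_cases hq2 : q = 2
  · subst hq2
    refine Or.inr (Or.inl ⟨rfl, ?_, ?_, ?_⟩)
    · rw [hD]; decide
    · rw [h4, h6]; decide
    · rw [h6]; decide
  · refine Or.inl fun h ↦ ?_
    obtain ⟨h12, -⟩ := h
    rw [hD] at h12
    have hq1 : (q : ℤ) ∣ 659664896 := dvd_neg.mp (dvd_trans (dvd_pow_self _ (by norm_num)) h12)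
    have hdvdN : q ∣ 2 ^ 12 * 11 ^ 5 := by
      have e : ((2 ^ 12 * 11 ^ 5 : ℕ) : ℤ) = 659664896 := by norm_num
      exact Int.natCast_dvd_natCast.mp (e ▸ hq1)
    have hpi := Nat.Prime.prime hq
    rcases hpi.dvd_or_dvd hdvdN with h | h
    · exact absurd ((Nat.prime_dvd_prime_iff_eq hq Nat.prime_two).mp (hpi.dvd_of_dvd_pow h)) hq2
    · have := (Nat.prime_dvd_prime_iff_eq hq (by norm_num : Nat.Prime 11)).mp (hpi.dvd_of_dvd_pow h)
      subst this; revert h12; norm_num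

/-- `C = [0, 1, 0, −165, 1427]` is globally minimal. [cite: Kraus1989, Prop. 2] -/
theorem isGloballyMinimal_C176b : (⟨0, 1, 0, -165, 1427⟩ : WeierstrassCurve ℚ).IsGloballyMinimal := by
  rw [show (⟨0, 1, 0, -165, 1427⟩ : WeierstrassCurve ℚ) = ⟨((0 : ℤ) : ℚ), ((1 : ℤ) : ℚ), ((0 : ℤ) : ℚ), ((-165 : ℤ) : ℚ), ((1427 : ℤ) : ℚ)⟩ by
    ext <;> norm_num]
  exact isGloballyMinimal_C176b_cast

/-- `C` is an elliptic curve (`Δ ≠ 0`). [folklore] -/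
theorem isElliptic_C176b : (⟨0, 1, 0, -165, 1427⟩ : WeierstrassCurve ℚ).IsElliptic :=
  ⟨by norm_num [WeierstrassCurve.Δ, WeierstrassCurve.b₂, WeierstrassCurve.b₄, WeierstrassCurve.b₆, WeierstrassCurve.b₈]⟩

/-- **The twist model**: `(u, r, s, t) = (½, −¼, 0, 0)` carries the tree's quadratic twist `(11a1)^{(−1)}` to `C`. [cite: SilvermanAEC2009, X.2 Prop. 2.4] -/
theorem twist_elevenA1_negOne :
    (⟨Units.mk0 (1 / 2 : ℚ) (by norm_num), -1 / 4, 0, 0⟩ : VariableChange ℚ) • (⟨0, -1, 1, -10, -20⟩ : WeierstrassCurve ℚ).quadraticTwist ((-1 : ℚ))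
      = (⟨0, 1, 0, -165, 1427⟩ : WeierstrassCurve ℚ) := by
  ext <;> simp [WeierstrassCurve.quadraticTwist, WeierstrassCurve.b₂, WeierstrassCurve.b₄, WeierstrassCurve.b₆,
    WeierstrassCurve.variableChange_a₁, WeierstrassCurve.variableChange_a₂, WeierstrassCurve.variableChange_a₃,
    WeierstrassCurve.variableChange_a₄, WeierstrassCurve.variableChange_a₆] <;> norm_num

/-- **Discriminants**: `(½)¹²·Δ(C) = (−1)⁶·Δ(11a1)` (`r = ½`: `v₂(Δ_min)` jumps by `12` under `χ₋₄` at a good prime `2`). [cite: CremonaAlgorithms1997, Table 1 (11a1, 176b)] -/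
theorem delta_twist_elevenA1_negOne : ((1 / 2 : ℚ)) ^ 12 * (⟨0, 1, 0, -165, 1427⟩ : WeierstrassCurve ℚ).Δ
    = ((-1 : ℚ)) ^ 6 * (⟨0, -1, 1, -10, -20⟩ : WeierstrassCurve ℚ).Δ := by
  norm_num [WeierstrassCurve.Δ, WeierstrassCurve.b₂, WeierstrassCurve.b₄, WeierstrassCurve.b₆, WeierstrassCurve.b₈]

/-! ## §2 The row `176b` on the level-`44` lift of `φ₁₁` -/

/-- `(φ₁₁)^{χ₋₄}` formed from level `11` equals `(ι₁φ₁₁)^{χ₋₄}` formed from level `44` (same `q`-expansion `χ₋₄(n)·aₙ(φ₁₁)`).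
[cite: Shimura1971, Prop. 3.64] [cite: DiamondShurman2005, §5.7] -/
theorem charTwist_phi11_eq_charTwist_iota :
    charTwist 176 (⟨16, rfl⟩ : 11 ∣ 176) (⟨11, rfl⟩ : 4 ^ 2 ∣ 176) isQuadratic_χ₄_ringHomComp cuspFormEtaProductEleven =
      charTwist 176 (⟨4, rfl⟩ : 44 ∣ 176) (⟨11, rfl⟩ : 4 ^ 2 ∣ 176) isQuadratic_χ₄_ringHomComp
        (degeneracyMap0 11 44 1 2 cuspFormEtaProductEleven) :=
  eq_of_forall_cuspCoeff_eq_gamma0 fun n ↦ by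
    rw [cuspCoeff_charTwist 176 _ _ isQuadratic_χ₄_ringHomComp isPrimitive_χ₄_ringHomComp,
      cuspCoeff_charTwist 176 _ _ isQuadratic_χ₄_ringHomComp isPrimitive_χ₄_ringHomComp,
      cuspCoeff_degeneracyMap0_one (⟨4, rfl⟩ : 11 ∣ 44)]

/-- **`Λ(D.f) ⊆ Λ_C` on the row `176b`** (`a₃(W) = 1`): Stevens (5.4) on the level-`44` lift, (S2)₁₁, and the twisted Néron lattice
`Λ_C = g(χ₋₄)⁻¹·Λ(11a1)` (`s = g/2`, `r = ½`). [cite: Stevens1989, Lemma (5.4) p. 97] [cite: Pal2012, Lemma 3.1] [cite: MontgomeryVaughan2007, Thm. 9.17] -/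
theorem periodLattice_le_C176b {W : WeierstrassCurve ℚ} [W.IsElliptic] (D : ModularParametrizationData W 176) (h3 : W.LFunction 3 = 1)
    {LC : PeriodPair} (hLC : IsNeronLatticeOf ((⟨0, 1, 0, -165, 1427⟩ : WeierstrassCurve ℚ).baseChange ℂ) LC) :
    ∀ z ∈ periodLattice D.f, z ∈ LC.lattice := by
  haveI := isElliptic_elevenA1
  obtain ⟨LA, hA2, hA3⟩ := ((⟨0, -1, 1, -10, -20⟩ : WeierstrassCurve ℚ).baseChange ℂ).exists_periodPair_of_isElliptic'
  have hLA : IsNeronLatticeOf ((⟨0, -1, 1, -10, -20⟩ : WeierstrassCurve ℚ).baseChange ℂ) LA := ⟨hA2, hA3⟩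
  set g : ℂ := gaussSum (ZMod.χ₄.ringHomComp (Int.castRingHom ℂ)) (ZMod.stdAddChar (N := 4)) with hg
  have hs2 : (g / 2) ^ 2 = (((-1 : ℚ)) : ℂ) := by
    rw [div_pow, hg, gaussSum_χ₄_ringHomComp_sq]; push_cast; norm_num
  have hiff := fun z ↦ neronLattice_mem_iff_of_twist_of_sq_eq (by norm_num : (-1 : ℚ) ≠ 0) _ twist_elevenA1_negOne
    delta_twist_elevenA1_negOne hs2 hLA hLC z
  intro z hz
  rw [f_eq_charTwist_eleven_of_lFunction_three D h3, charTwist_phi11_eq_charTwist_iota] at hz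
  have h1 : g * z ∈ LA.lattice := periodLatticeLe_iota_phi11 hLA _
    (gaussSum_mul_mem_periodLattice_of_mem_charTwist 176 (⟨4, rfl⟩ : 44 ∣ 176) (⟨11, rfl⟩ : 4 ^ 2 ∣ 176)
      isQuadratic_χ₄_ringHomComp isPrimitive_χ₄_ringHomComp _ hz)
  rw [hiff]
  convert h1 using 1
  push_cast
  ring

/-! ## §3 `|c| = 1` on the row `176b` and on all of `X₀(176)` -/

/-- **`176b`: `|c(D)| = 1` for every lattice-optimal `X₀(176)`-datum with `a₃(W) = 1`** — UNCONDITIONAL (p3's Néron squeeze with the globally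
minimal `C`). [cite: AgasheRibetStein2006, §§1–2] [cite: CremonaAlgorithms1997, Table 1 (11a1, 176b)] -/
theorem abs_maninConstant_eq_one_oneSeventySix_of_lFunction_three_eq_one (W : WeierstrassCurve ℚ) [W.IsElliptic] [W.IsGloballyMinimal]
    (D : ModularParametrizationData W 176) (h3 : W.LFunction 3 = 1)
    (hopt : ∀ z ∈ D.L.lattice, ∃ w ∈ periodLattice D.f, z = D.c * w) : |D.maninConstant| = 1 := by
  haveI := isElliptic_C176b
  haveI := isGloballyMinimal_C176b
  obtain ⟨LC, h2, h3'⟩ := ((⟨0, 1, 0, -165, 1427⟩ : WeierstrassCurve ℚ).baseChange ℂ).exists_periodPair_of_isElliptic'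
  have hLC : IsNeronLatticeOf ((⟨0, 1, 0, -165, 1427⟩ : WeierstrassCurve ℚ).baseChange ℂ) LC := ⟨h2, h3'⟩
  exact NeronSqueeze.abs_maninConstant_eq_one_of_periodLattice_le (⟨0, 1, 0, -165, 1427⟩ : WeierstrassCurve ℚ) LC hLC W D
    (periodLattice_le_C176b D h3 hLC) hopt

/-- **`|c| = 1` FOR EVERY LATTICE-OPTIMAL `X₀(176)`-DATUM of every globally minimal elliptic curve over `ℚ`** — UNCONDITIONAL (rows `a, c`:
p2 g31; row `b`: this file). [cite: Manin1972, Prop. 1.4] [cite: AgasheRibetStein2006, §§1–2] [cite: CremonaAlgorithms1997, Table 1 (176a–c)] -/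
theorem abs_maninConstant_eq_one_oneSeventySix (W : WeierstrassCurve ℚ) [W.IsElliptic] [W.IsGloballyMinimal]
    (D : ModularParametrizationData W 176) (hopt : ∀ z ∈ D.L.lattice, ∃ w ∈ periodLattice D.f, z = D.c * w) :
    |D.maninConstant| = 1 := by
  by_cases h3 : W.LFunction 3 = 1
  · exact abs_maninConstant_eq_one_oneSeventySix_of_lFunction_three_eq_one W D h3 hopt
  · exact abs_maninConstant_eq_one_oneSeventySix_of_lFunction_three_ne_one W D h3 hopt

/-- **C2 `ManinOddAtFour` at `N = 176` (`2² ∣ 176`): `2 ∤ c(D)`** for every lattice-optimal `X₀(176)`-datum — UNCONDITIONAL. [cite: AgasheRibetStein2006, §§1–2] -/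
theorem not_two_dvd_maninConstant_oneSeventySix (W : WeierstrassCurve ℚ) [W.IsElliptic] [W.IsGloballyMinimal]
    (D : ModularParametrizationData W 176) (hopt : ∀ z ∈ D.L.lattice, ∃ w ∈ periodLattice D.f, z = D.c * w) :
    ¬ (2 : ℤ) ∣ D.maninConstant := by
  have h := abs_maninConstant_eq_one_oneSeventySix W D hopt
  intro h2
  have := Int.le_of_dvd (by rw [h]; norm_num) ((dvd_abs _ _).mpr h2)
  rw [h] at this
  norm_num at this

/-- **No prime divides `c` on `X₀(176)`.** [cite: AgasheRibetStein2006, §§1–2] -/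
theorem not_prime_dvd_maninConstant_oneSeventySix (W : WeierstrassCurve ℚ) [W.IsElliptic] [W.IsGloballyMinimal]
    (D : ModularParametrizationData W 176) (hopt : ∀ z ∈ D.L.lattice, ∃ w ∈ periodLattice D.f, z = D.c * w)
    {p : ℕ} (hp : p.Prime) : ¬ (p : ℤ) ∣ D.maninConstant := by
  have h := abs_maninConstant_eq_one_oneSeventySix W D hopt
  intro hpd
  have h1 := Int.le_of_dvd (by rw [h]; norm_num) ((dvd_abs _ _).mpr hpd)
  rw [h] at h1
  have := hp.two_le
  omega

/-- **The C2 conclusion on the whole `X₀(176)`-domain**: `2² ∣ 176`, and `|c| = 1 ∧ 2 ∤ c` for every lattice-optimal `X₀(176)`-datum of every globally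
minimal elliptic curve over `ℚ` — UNCONDITIONAL; BSD and C2 for general `N` are NOT proved by this. [folklore] -/
theorem maninOddAtFour_oneSeventySix :
    2 ^ 2 ∣ 176 ∧ ∀ (W : WeierstrassCurve ℚ) [W.IsElliptic] [W.IsGloballyMinimal] (D : ModularParametrizationData W 176),
      (∀ z ∈ D.L.lattice, ∃ w ∈ periodLattice D.f, z = D.c * w) → |D.maninConstant| = 1 ∧ ¬ (2 : ℤ) ∣ D.maninConstant :=
  ⟨⟨44, by norm_num⟩, fun W _ _ D hopt ↦ ⟨abs_maninConstant_eq_one_oneSeventySix W D hopt, not_two_dvd_maninConstant_oneSeventySix W D hopt⟩⟩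

end Summit.BirchSwinnertonDyer.BirchSwinnertonDyer.Theorems.ManinLocalTwoThree.LevelOneSeventySix

end
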